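import Literature.InformationTheory.Coding.PolarizationTree
import Literature.InformationTheory.Coding.SourcePolarizationLeafProfile
import HarnessLib

/-!
# Binary sources with side information form a polarization tree (Arıkan's one-step relations)

Topic `Literature/InformationTheory/Coding`.  The class `Src` of binary sources with functional
side information (uniform source bit, `Literature/InformationTheory/Coding/SourcePolarizationStep.lean`)
carries the structure `PolarTree.StepBounds` of
`Literature/InformationTheory/Coding/PolarizationTree.lean`: with `minus`/`plus` Arıkan's one-step
transforms, `H = condEnt` the conditional entropy and `Z` the Bhattacharyya parameter, the ten
one-step relations hold —
`0 ≤ Z ≤ 1`, `0 ≤ H ≤ 1`, `H⁻ + H⁺ = 2H`, `Z⁺ = Z²`, `Z√(2−Z²) ≤ Z⁻ ≤ 2Z − Z²`,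
`Z² ≤ H ≤ log₂(1+Z)` (all proved in the companions `SourcePolarizationStep*.lean`;
[Arıkan 2009, Prop. 5; Arıkan 2010, Prop. 1–2; Korada–Urbanke 2010, Lemma 17]) — packaged as the
structure VALUE `Src.stepBounds`; and the leakage profile of a source IS the profile of conditional
entropies of the leaves of its `(minus, plus)`-tree in natural index order:
`leak S.g s j = (leaf Src.minus Src.plus s S j).H` (`leak_eq_H_leaf`: `PolarTree.leaf` obeys the
three defining equations of `leak_eq_H_of_leaf`, `SourcePolarizationLeafProfile.lean`).  Consequently every theorem about the leaves of an
abstract polarization tree (rough / fine polarization) applies verbatim to the leakage profiles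
`leak g s` of `SourcePolarization.lean`.

## References

* E. Arıkan, *Source polarization*, Proc. IEEE ISIT 2010, §III, Prop. 1–2, Thm 1.  bib `Arikan2010`.
* E. Arıkan, *Channel polarization…*, IEEE Trans. IT 55 (2009), Prop. 5, §VII.  bib `Arikan2009`.
* S. B. Korada, R. Urbanke, *Polar codes are optimal for lossy source coding*, IEEE Trans. IT 56
  (2010), Lemma 17.  bib `KoradaUrbanke2010`.
-/

noncomputable section

namespace Literature.InformationTheory.Coding.Polar

open Finset Literature.InformationTheory.Entropy Literature.InformationTheory.Coding.PolarTree

/-- **Binary sources with functional side information satisfy Arıkan's one-step relations**: the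
`PolarTree.StepBounds` structure on `Src` with `minus := Src.minus`, `plus := Src.plus`,
`H := Src.H` (conditional entropy `H(B|Y)`, bits) and `Z := Src.zParam` (Bhattacharyya parameter).
[cite: Arikan2010, Prop. 1–2 (with Arikan2009 Prop. 5 and KoradaUrbanke2010 Lemma 17 for Z⁻)] -/
def Src.stepBounds : StepBounds Src where
  minus := Src.minus
  plus := Src.plus
  H := Src.H
  Z := Src.zParam
  Z_nonneg := Src.zParam_nonneg
  Z_le_one := Src.zParam_le_one
  H_nonneg := Src.H_nonneg
  H_le_one := Src.H_le_one
  H_step := Src.H_step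
  Z_plus := Src.zParam_plus_eq
  Z_minus_le := Src.zParam_minus_le
  Z_minus_ge := Src.zParam_minus_ge
  sq_Z_le_H := Src.sq_zParam_le_H
  H_le_logb := Src.H_le_logb

/-- The fields of `Src.stepBounds`, unfolded. [folklore] -/
@[simp] theorem Src.stepBounds_minus : Src.stepBounds.minus = Src.minus := rfl

/-- The fields of `Src.stepBounds`, unfolded. [folklore] -/
@[simp] theorem Src.stepBounds_plus : Src.stepBounds.plus = Src.plus := rfl

/-- The fields of `Src.stepBounds`, unfolded. [folklore] -/
@[simp] theorem Src.stepBounds_H : Src.stepBounds.H = Src.H := rfl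

/-- The fields of `Src.stepBounds`, unfolded. [folklore] -/
@[simp] theorem Src.stepBounds_Z : Src.stepBounds.Z = Src.zParam := rfl

/-- **The leakage profile is the leaf profile of the source tree**: for every packaged source `S`,
`leak S.g s j = H(leaf_j)`, where `leaf_j = leaf Src.minus Src.plus s S j` is the `j`-th synthetic
source at depth `s` (natural index order: the TOP bit of `j` chooses between `S⁻` and `S⁺` first).
[cite: Arikan2010, §III (H(U_i | U^{i-1}, Y^N) computed recursively through the transforms)] -/
theorem leak_eq_H_leaf (S : Src) (s : ℕ) (j : Fin (2 ^ s)) :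
    leak S.g s j = (leaf Src.minus Src.plus s S j).H :=
  leak_eq_H_of_leaf (leaf Src.minus Src.plus) (fun _ _ => rfl) (fun s S c => by simp [leaf, loIdx])
    (fun s S c => by simp [leaf, hiIdx]) S s j

/-- The leaf profile form of the leakage profile of an unpackaged source `g`. [cite: Arikan2010, §III (H(U_i | U^{i-1}, Y^N) computed recursively through the transforms)] -/
theorem leak_eq_stepBounds_H {m : ℕ} {β : Type} [DecidableEq β] (g : ZMod 2 → (Fin m → ZMod 2) → β)
    (s : ℕ) (j : Fin (2 ^ s)) :
    leak g s j = Src.stepBounds.H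
      (leaf Src.stepBounds.minus Src.stepBounds.plus s (Src.mk m β g) j) :=
  leak_eq_H_leaf (Src.mk m β g) s j

end Literature.InformationTheory.Coding.Polar

end
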